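/-
Copyright (c) 2026 the pub-hodgecm-mathlib formalisation cell (harness21).  Prover seat hodgecm-mathlib-K2Liu-p08 (g0), Track B «K2-LIT»,
#184♮ = hLiu418 = `stmt-HodgeConjecture-24832`; LEAD F0P6-plan (g12) RULING «M-156e» (O2) 2026-09-04T06:23:45Z + 06:26:47Z «resGen leaf → G1»;
SIGS-RoadI-v3 §G1 (G1.2 «continuation»), my CENSUS-G1 902413b7e1767055 file 1.  Road I v3, organ G1, file 1 (the continuation side).
-/
import Summits.HodgeConjecture.HodgeConjecture.Theorems.K2LiuContinuedPairingHolomorphic   -- ★ #43a engine: `norm_deriv_le_of_bound`, `aestronglyMeasurable_deriv_slice`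
import Summits.HodgeConjecture.HodgeConjecture.Theorems.K2LiuFirstTermResidueForm          -- ★ U0 (`resNorm`, `re_half_pos`) and the #41 frame
import Mathlib.Analysis.Calculus.ParametricIntervalIntegral
import Mathlib.MeasureTheory.Integral.IntervalIntegral.FundThmCalculus
import Mathlib.Analysis.Complex.Convex
import HarnessLib

/-!
# Crux `HLiu418`, Road I v3, organ G1 file 1: TRANSPORT OF A `t`-DERIVATIVE IDENTITY FROM THE HALF-PLANE OF CONVERGENCE TO THE WHOLE DOMAIN OF
# HOLOMORPHY of a pole-cleared continuation (`𝔤_∞`-equivariance of the continuation, the continuation side)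

Cell `hodgecm-mathlib`, crux item hLiu418 = `stmt-HodgeConjecture-24832`; LEAD F0P6-plan (g12) (M-156e (O2)), co-dealer K2E5-plan (g5) (SIGS §G1), boxes
K2E5-r01 (g6) ∕ K2Liu-ref1 (g2).  THEOREMS ONLY (no `def`, no instance, no notation, no named-fact hypothesis, no `sorry`); lane
`--supports stmt-HodgeConjecture-24832 --as helper` (count-neutral).  Consumers: G1 file 2 `K2LiuResidueLieDerivative` (the residue form), Hol (holomorphic
type of the residue), U5; Road Φ's `K_∞`-type transport.

THE MATHEMATICS (SIGS §G1.2, simplified: NO test functions, NO du Bois-Reymond — the INTEGRATED identity is transported instead of the weak one).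
§1 (ENGINE, pure complex analysis).  Let `Ω = {a < re}` (convex), `U W : ℂ → ℝ → ℂ` with `s ↦ U s t`, `s ↦ W s t` holomorphic on `Ω` for every `t`
(socket #41 clause (i) along an orbit), `t ↦ W s t` continuous for `s ∈ Ω` (clause (ii)), and `W` LOCALLY UNIFORMLY BOUNDED: near every `z ∈ Ω`, `‖W s t‖ ≤ C` for
`|t| ≤ R` (clause (v) along an orbit segment of bounded height).  If on a far half-plane `{s₁ < re}` the TERM-WISE identity `∂_t U(s, t) = W(s, t)` holds (G1.1,
BY VALUE), then it holds for EVERY `s ∈ Ω` (`hasDerivAt_of_hasDerivAt_on_halfPlane`).  Proof: for `re s > s₁`, `U(s,t) − U(s,0) = ∫₀ᵗ W(s,τ)dτ` (FTC); both sides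
are holomorphic in `s` on `Ω` (the integral by differentiation under `∫₀ᵗ` with Cauchy's estimate on an inner disc, ★ #43a engine); identity theorem on the
convex `Ω`; then FTC-2 at every `s ∈ Ω` (`W s` continuous).
§2 (the #41 currency).  For pole-cleared continuations `(P, E⋆)` of `f` and `(P′, E′)` of the derived family `f′` (clauses (i), (ii), (v) BY VALUE, any frame
`N M n`), a continuous orbit `γ : ℝ → H(𝔸)` whose height stays between two positive bounds on every segment (e.g. `t ↦ h · ι_∞(exp tX)`, ★
`UnitaryGroup.expGL_smul_mem_arch` + `archToAdelic`), and the term-wise identity on `{s₁ < re}` for the QUOTIENTS `E⋆/∏_P`, `E′/∏_{P′}` (= the identity for the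
convergent series `E^Δ(f_s)`, `E^Δ(f′_s)`, G1.1): for EVERY `s ∈ {0 < re}` the POLYNOMIAL-CLEARED identity
`∂_t [E⋆(s, γ t) · ∏_{P′}(s − p)] = E′(s, γ t) · ∏_P(s − p)` (`hasDerivAt_continuation_orbit`) — valid AT the poles — and, off `P ∪ P′`, the quotient identity
(`hasDerivAt_continuation_quotient_orbit`).
[MoeglinWaldspurger1995, IV.1.9–IV.1.11 (holomorphic families of automorphic forms, derivatives in the group variable)] [BorelJacquet1979, §4.1]
[Liu2021, Lem. B.12] [GanQiuTakeda2014, §3.2].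
HONEST LABEL.  Count-neutral helper; G1 closes no socket by itself; `HC_CM` is proved only modulo the 7 printed citations (2 remaining named inputs:
hLiu418 = `stmt-HodgeConjecture-24832`, h413 = `stmt-HodgeConjecture-24833`) until rung 0 closes.
-/

set_option autoImplicit false
set_option linter.dupNamespace false -- the mandated namespace repeats `HodgeConjecture.HodgeConjecture`
set_option Elab.async false

noncomputable section

open NumberField IsDedekindDomain Filter MeasureTheory Metric Set Complex intervalIntegral
open scoped Topology BigOperators Interval

namespace Summit.HodgeConjecture.HodgeConjecture.Cruxes.HLiu418.K2LiuContinuationLieDerivative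

open Summit.HodgeConjecture.HodgeConjecture.Cruxes.HLiu418.K2LiuContinuedPairingHolomorphic (norm_deriv_le_of_bound aestronglyMeasurable_deriv_slice)

/-! ## §1 ENGINE: holomorphy of `s ↦ ∫₀ᵗ W(s, τ) dτ` and transport of `∂_t U = W` from a half-plane -/

/-- **holomorphy of a parametric interval integral from locally uniform bounds**: if `s ↦ W s τ` is holomorphic on the open `O` for every `τ`, `τ ↦ W s τ` is
continuous for `s ∈ O`, and near every `z ∈ O` one has `‖W s τ‖ ≤ C` for `τ ∈ [−R, R]`, then `s ↦ ∫ τ in 0..t, W s τ` is holomorphic on `O` for `|t| ≤ R`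
(differentiation under the integral with Cauchy's estimate on an inner disc, ★ #43a engine). [cite: MoeglinWaldspurger1995, IV.1.9] -/
theorem differentiableOn_intervalIntegral_param {O : Set ℂ} (hO : IsOpen O) {W : ℂ → ℝ → ℂ}
    (hW : ∀ τ, DifferentiableOn ℂ (fun s => W s τ) O) (hWc : ∀ s ∈ O, Continuous (W s))
    {R : ℝ} (hWb : ∀ z ∈ O, ∃ C r : ℝ, 0 < r ∧ ∀ s : ℂ, dist s z < r → ∀ τ : ℝ, |τ| ≤ R → ‖W s τ‖ ≤ C)
    {t : ℝ} (ht : |t| ≤ R) :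
    DifferentiableOn ℂ (fun s => ∫ τ in (0 : ℝ)..t, W s τ) O := by
  intro z hz
  obtain ⟨C, r, hr, hC⟩ := hWb z hz
  obtain ⟨ρ, hρ, hball⟩ := Metric.isOpen_iff.1 hO z hz
  set δ : ℝ := min r ρ / 2 with hδdef
  have hδ : 0 < δ := by rw [hδdef]; positivity
  have h2δr : 2 * δ ≤ r := by rw [hδdef]; linarith [min_le_left r ρ]
  have h2δρ : 2 * δ ≤ ρ := by rw [hδdef]; linarith [min_le_right r ρ]
  have hballO : ball z (2 * δ) ⊆ O := fun w hw => hball (ball_subset_ball h2δρ hw)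
  -- every `τ` in the interval of integration satisfies `|τ| ≤ |t| ≤ R`
  have hτR : ∀ τ ∈ Ι (0 : ℝ) t, |τ| ≤ R := by
    intro τ hτ
    rw [Set.mem_uIoc] at hτ
    refine le_trans ?_ ht
    rcases hτ with ⟨h1, h2⟩ | ⟨h1, h2⟩
    · rw [abs_of_pos h1]; exact h2.trans (le_abs_self t)
    · rw [abs_of_nonpos h2]; exact (neg_le_neg h1.le).trans (neg_le_abs t)
  -- derivative bound on `ball z δ`
  have hderiv : ∀ τ, |τ| ≤ R → ∀ s ∈ ball z δ, ‖deriv (fun s => W s τ) s‖ ≤ 2 * max C 0 / δ := by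
    intro τ hτ s hs
    refine norm_deriv_le_of_bound hδ le_rfl ((hW τ).mono hballO) (fun w hw => hC w ?_ τ hτ) hs
    rw [mem_ball] at hw
    exact lt_of_lt_of_le hw h2δr
  have key := intervalIntegral.hasDerivAt_integral_of_dominated_loc_of_deriv_le (μ := volume) (a := (0 : ℝ)) (b := t)
    (F := fun s τ => W s τ) (F' := fun s τ => deriv (fun s => W s τ) s) (x₀ := z) (s := ball z δ) (bound := fun _ => 2 * max C 0 / δ)
    (ball_mem_nhds z hδ)
    (Filter.eventually_of_mem (hO.mem_nhds hz) fun s' hs' => (hWc s' hs').aestronglyMeasurable)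
    ((hWc z hz).intervalIntegrable _ _)
    (aestronglyMeasurable_deriv_slice _ hO hz (fun s hs => (hWc s hs).aestronglyMeasurable) hW)
    (Filter.Eventually.of_forall fun τ hτ s hs => hderiv τ (hτR τ hτ) s hs)
    intervalIntegrable_const
    (Filter.Eventually.of_forall fun τ _ s hs =>
      ((hW τ).differentiableAt (hO.mem_nhds (hballO (ball_subset_ball (by linarith) hs)))).hasDerivAt)
  exact key.2.differentiableAt.differentiableWithinAt

/-- **TRANSPORT OF `∂_t U = W` FROM A HALF-PLANE (G1.2 engine).**  `Ω = {a < re}`; `s ↦ U s t` and `s ↦ W s t` holomorphic on `Ω` for every `t`;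
`t ↦ W s t` continuous for `s ∈ Ω`; `W` locally uniformly bounded on every `t`-segment near every point of `Ω`; and the TERM-WISE identity
`HasDerivAt (U s) (W s t) t` for all `t` when `s₁ < re s` (`a ≤ s₁`).  Then `HasDerivAt (U s) (W s t) t` for ALL `s ∈ Ω` and all `t`: the integrated identity
`U(s,t) − U(s,0) = ∫₀ᵗ W(s,τ)dτ` holds on `{s₁ < re}` (FTC), both sides are holomorphic on the convex `Ω`, so it holds on `Ω` (identity theorem), and `W s` is
continuous (FTC-2). [cite: MoeglinWaldspurger1995, IV.1.9–IV.1.11] [cite: BorelJacquet1979, §4.1] -/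
theorem hasDerivAt_of_hasDerivAt_on_halfPlane {U W : ℂ → ℝ → ℂ} {a s₁ : ℝ} (hs₁ : a ≤ s₁)
    (hU : ∀ t, DifferentiableOn ℂ (fun s => U s t) {s : ℂ | a < s.re})
    (hW : ∀ t, DifferentiableOn ℂ (fun s => W s t) {s : ℂ | a < s.re})
    (hWc : ∀ s : ℂ, a < s.re → Continuous (W s))
    (hWb : ∀ z : ℂ, a < z.re → ∀ R : ℝ, ∃ C r : ℝ, 0 < r ∧ ∀ s : ℂ, dist s z < r → ∀ τ : ℝ, |τ| ≤ R → ‖W s τ‖ ≤ C)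
    (hterm : ∀ s : ℂ, s₁ < s.re → ∀ t, HasDerivAt (U s) (W s t) t)
    (s : ℂ) (hs : a < s.re) (t : ℝ) : HasDerivAt (U s) (W s t) t := by
  have hO : IsOpen {s : ℂ | a < s.re} := isOpen_lt continuous_const Complex.continuous_re
  -- the integrated identity on `Ω`, pointwise in `t′`
  have hint : ∀ t' : ℝ, U s t' - U s 0 = ∫ τ in (0 : ℝ)..t', W s τ := by
    intro t'
    -- `D(s) := U s t′ − U s 0 − ∫₀^{t′} W s` is holomorphic on `Ω` and vanishes on `{s₁ < re}`
    have hI : DifferentiableOn ℂ (fun s => ∫ τ in (0 : ℝ)..t', W s τ) {s : ℂ | a < s.re} :=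
      differentiableOn_intervalIntegral_param hO hW (fun s hs => hWc s hs) (R := |t'|)
        (fun z hz => hWb z hz |t'|) le_rfl
    have hD : DifferentiableOn ℂ (fun s => U s t' - U s 0 - ∫ τ in (0 : ℝ)..t', W s τ) {s : ℂ | a < s.re} :=
      ((hU t').sub (hU 0)).sub hI
    have hfar : ∀ w : ℂ, s₁ < w.re → U w t' - U w 0 - ∫ τ in (0 : ℝ)..t', W w τ = 0 := by
      intro w hw
      rw [sub_eq_zero]
      exact (intervalIntegral.integral_eq_sub_of_hasDerivAt (fun τ _ => hterm w hw τ)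
        ((hWc w (lt_of_le_of_lt hs₁ hw)).intervalIntegrable _ _)).symm
    set z₁ : ℂ := ⟨max a s₁ + 1, 0⟩ with hz₁def
    have hz₁ : a < z₁.re := by simp only [hz₁def]; linarith [le_max_left a s₁]
    have hz₁' : s₁ < z₁.re := by simp only [hz₁def]; linarith [le_max_right a s₁]
    have hev : (fun s => U s t' - U s 0 - ∫ τ in (0 : ℝ)..t', W s τ) =ᶠ[𝓝 z₁] 0 := by
      filter_upwards [(isOpen_lt continuous_const Complex.continuous_re).mem_nhds hz₁'] with w hw using hfar w hw
    have hzero := (hD.analyticOnNhd hO).eqOn_zero_of_preconnected_of_eventuallyEq_zero (convex_halfSpace_re_gt a).isPreconnected hz₁ hev hs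
    simp only [Pi.zero_apply] at hzero
    exact sub_eq_zero.1 hzero
  -- FTC-2 at `s`
  have hUeq : U s = fun t' => U s 0 + ∫ τ in (0 : ℝ)..t', W s τ := by
    funext t'
    rw [← hint t', add_sub_cancel]
  rw [hUeq]
  have hF : HasDerivAt (fun t' => ∫ τ in (0 : ℝ)..t', W s τ) (W s t) t :=
    intervalIntegral.integral_hasDerivAt_right ((hWc s hs).intervalIntegrable _ _)
      ((hWc s hs).stronglyMeasurableAtFilter _ _) (hWc s hs).continuousAt
  exact hF.const_add (U s 0)

/-! ## §2 The #41 currency: derivative of a pole-cleared continuation along a continuous orbit in `H(𝔸)` -/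

section Frame

open Literature.NumberTheory.Automorphic
open Literature.NumberTheory.GaloisRepresentations
open Literature.NumberTheory.GelbartRogawski1991 Literature.NumberTheory.GelbartRogawski1991.GRConstruction
open Literature.NumberTheory.K2Lit.SiegelDoubled
open Summit.HodgeConjecture.HodgeConjecture.Cruxes.HLiu418.K2LiuFirstTermResidueForm (re_half_pos)
open Summit.HodgeConjecture.HodgeConjecture.Cruxes.HLiu418.K2LiuEisensteinResidueOfGenerators (prod_sub_ne_zero)

variable (L : Type) [Field L] [NumberField L] [IsCMField L]
variable {N M n : ℕ} (e : Fin N × Fin M ≃ Fin n)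
  (dV : Fin N → L) (hdV : ∀ i, IsCMField.complexConj L (dV i) = dV i)
  (dW : Fin M → L) (hdW : ∀ i, IsCMField.complexConj L (dW i) = dW i)

/-- along an orbit segment whose height stays in `[B₁, B₂] ⊂ (0, ∞)`, clause (v) of socket #41 gives a UNIFORM bound `‖E⋆(s, γ t)‖ ≤ C′` near every
`z ∈ {0 < re}` (`x^A ≤ max (B₁^A) (B₂^A)` for `x ∈ [B₁, B₂]`, any real `A`). [cite: MoeglinWaldspurger1995, IV.1.9] -/
theorem exists_bound_orbit (Es : ℂ → HA L e dV hdV dW hdW → ℂ)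
    (hv : ∀ z : ℂ, 0 < z.re → ∃ C A r : ℝ, 0 < r ∧ ∀ s : ℂ, dist s z < r → ∀ h : HA L e dV hdV dW hdW,
      ‖Es s h‖ ≤ C * adelicHeightGL (n + n) L (h : GL (Fin (n + n)) (AdeleRing (𝓞 L) L)) ^ A)
    (γ : ℝ → HA L e dV hdV dW hdW)
    (hγ : ∀ R : ℝ, ∃ B₁ B₂ : ℝ, 0 < B₁ ∧ ∀ t : ℝ, |t| ≤ R →
      B₁ ≤ adelicHeightGL (n + n) L ((γ t : HA L e dV hdV dW hdW) : GL (Fin (n + n)) (AdeleRing (𝓞 L) L)) ∧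
        adelicHeightGL (n + n) L ((γ t : HA L e dV hdV dW hdW) : GL (Fin (n + n)) (AdeleRing (𝓞 L) L)) ≤ B₂)
    (z : ℂ) (hz : 0 < z.re) (R : ℝ) :
    ∃ C r : ℝ, 0 < r ∧ ∀ s : ℂ, dist s z < r → ∀ t : ℝ, |t| ≤ R → ‖Es s (γ t)‖ ≤ C := by
  obtain ⟨C, A, r, hr, hC⟩ := hv z hz
  obtain ⟨B₁, B₂, hB₁, hB⟩ := hγ R
  refine ⟨max C 0 * max (B₁ ^ A) (B₂ ^ A), r, hr, fun s hs t ht => ?_⟩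
  obtain ⟨h1, h2⟩ := hB t ht
  set x : ℝ := adelicHeightGL (n + n) L ((γ t : HA L e dV hdV dW hdW) : GL (Fin (n + n)) (AdeleRing (𝓞 L) L)) with hx
  have hxpos : 0 < x := lt_of_lt_of_le hB₁ h1
  have hxA : x ^ A ≤ max (B₁ ^ A) (B₂ ^ A) := by
    rcases le_or_gt 0 A with hA | hA
    · exact (Real.rpow_le_rpow hxpos.le h2 hA).trans (le_max_right _ _)
    · exact (Real.rpow_le_rpow_of_nonpos hB₁ h1 hA.le).trans (le_max_left _ _)
  calc ‖Es s (γ t)‖ ≤ C * x ^ A := hC s hs (γ t)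
    _ ≤ max C 0 * x ^ A := mul_le_mul_of_nonneg_right (le_max_left C 0) (Real.rpow_nonneg hxpos.le A)
    _ ≤ max C 0 * max (B₁ ^ A) (B₂ ^ A) := mul_le_mul_of_nonneg_left hxA (le_max_right C 0)

/-- **G1.2 IN THE #41 CURRENCY — THE DERIVATIVE OF A POLE-CLEARED CONTINUATION ALONG AN ORBIT.**  Data BY VALUE: `(P, E⋆)` with socket #41's clauses (i), (ii),
(v) for a family `f`, `(P′, E′)` with (i), (ii), (v) for the derived family `f′`; a continuous orbit `γ : ℝ → H(𝔸)` with height in a compact of `(0, ∞)` on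
every segment (e.g. `t ↦ h · ι_∞(exp tX)`); and the TERM-WISE identity of G1.1 on a half-plane `{s₁ < re}` (`0 ≤ s₁`), stated for the quotients
`E⋆/∏_P`, `E′/∏_{P′}` (= the convergent series there).  Conclusion, for EVERY `s` with `0 < re s` and every `t`: the POLYNOMIAL-CLEARED identity
`HasDerivAt (fun t => E⋆ s (γ t) * ∏_{p∈P′}(s − p)) (E′ s (γ t) * ∏_{p∈P}(s − p)) t` — valid AT the poles. [cite: MoeglinWaldspurger1995, IV.1.9–IV.1.11]
[cite: BorelJacquet1979, §4.1] [cite: Liu2021, Lem. B.12 pp. 103–104] -/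
theorem hasDerivAt_continuation_orbit
    (P : Finset ℂ) (Es : ℂ → HA L e dV hdV dW hdW → ℂ)
    (hd : ∀ h : HA L e dV hdV dW hdW, DifferentiableOn ℂ (fun s => Es s h) {s : ℂ | 0 < s.re})
    (P' : Finset ℂ) (E' : ℂ → HA L e dV hdV dW hdW → ℂ)
    (hd' : ∀ h : HA L e dV hdV dW hdW, DifferentiableOn ℂ (fun s => E' s h) {s : ℂ | 0 < s.re})
    (hii' : ∀ s : ℂ, 0 < s.re → Continuous (E' s))
    (hv' : ∀ z : ℂ, 0 < z.re → ∃ C A r : ℝ, 0 < r ∧ ∀ s : ℂ, dist s z < r → ∀ h : HA L e dV hdV dW hdW,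
      ‖E' s h‖ ≤ C * adelicHeightGL (n + n) L (h : GL (Fin (n + n)) (AdeleRing (𝓞 L) L)) ^ A)
    (γ : ℝ → HA L e dV hdV dW hdW) (hγc : Continuous γ)
    (hγ : ∀ R : ℝ, ∃ B₁ B₂ : ℝ, 0 < B₁ ∧ ∀ t : ℝ, |t| ≤ R →
      B₁ ≤ adelicHeightGL (n + n) L ((γ t : HA L e dV hdV dW hdW) : GL (Fin (n + n)) (AdeleRing (𝓞 L) L)) ∧
        adelicHeightGL (n + n) L ((γ t : HA L e dV hdV dW hdW) : GL (Fin (n + n)) (AdeleRing (𝓞 L) L)) ≤ B₂)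
    {s₁ : ℝ} (hs₁ : 0 ≤ s₁)
    (hterm : ∀ s : ℂ, s₁ < s.re → ∀ t : ℝ,
      HasDerivAt (fun t => Es s (γ t) / ∏ p ∈ P, (s - p)) (E' s (γ t) / ∏ p ∈ P', (s - p)) t)
    (s : ℂ) (hs : 0 < s.re) (t : ℝ) :
    HasDerivAt (fun t => Es s (γ t) * ∏ p ∈ P', (s - p)) (E' s (γ t) * ∏ p ∈ P, (s - p)) t := by
  -- push the agreement abscissa to the right of all roots, where the quotient identity clears to the polynomial one
  set s₂ : ℝ := s₁ + (∑ p ∈ P, ‖p‖ + ∑ p ∈ P', ‖p‖) with hs₂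
  have hP0 : 0 ≤ ∑ p ∈ P, ‖p‖ := Finset.sum_nonneg fun p _ => norm_nonneg p
  have hP0' : 0 ≤ ∑ p ∈ P', ‖p‖ := Finset.sum_nonneg fun p _ => norm_nonneg p
  refine hasDerivAt_of_hasDerivAt_on_halfPlane (a := 0) (s₁ := s₂) (by linarith)
    (U := fun s t => Es s (γ t) * ∏ p ∈ P', (s - p)) (W := fun s t => E' s (γ t) * ∏ p ∈ P, (s - p))
    (fun t => (hd (γ t)).mul (DifferentiableOn.fun_finsetProd fun p _ => differentiableOn_id.sub (differentiableOn_const _)))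
    (fun t => (hd' (γ t)).mul (DifferentiableOn.fun_finsetProd fun p _ => differentiableOn_id.sub (differentiableOn_const _)))
    (fun s hs => ((hii' s hs).comp hγc).mul continuous_const)
    (fun z hz R => ?_) (fun w hw t => ?_) s hs t
  · obtain ⟨C, r, hr, hC⟩ := exists_bound_orbit L e dV hdV dW hdW E' hv' γ hγ z hz R
    refine ⟨max C 0 * ∏ p ∈ P, (‖z‖ + r + ‖p‖), r, hr, fun s hs t ht => ?_⟩
    rw [norm_mul, norm_prod]
    have hs' : ‖s‖ ≤ ‖z‖ + r := by
      have h1 : ‖s‖ ≤ ‖z‖ + dist s z := by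
        calc ‖s‖ = ‖z + (s - z)‖ := by rw [add_sub_cancel]
          _ ≤ ‖z‖ + ‖s - z‖ := norm_add_le _ _
          _ = ‖z‖ + dist s z := by rw [dist_eq_norm]
      linarith [hs.le]
    refine mul_le_mul ((hC s hs t ht).trans (le_max_left _ _)) ?_ (Finset.prod_nonneg fun p _ => norm_nonneg _) (le_max_right _ _)
    exact Finset.prod_le_prod (fun p _ => norm_nonneg _) fun p _ =>
      (norm_sub_le s p).trans (by linarith)
  · -- on `{s₂ < re}` no root is met, and the quotient identity clears
    have hw0 : s₁ < w.re := by
      have : s₂ < w.re := hw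
      linarith
    have hwP : w ∉ P := Summit.HodgeConjecture.HodgeConjecture.Cruxes.HLiu418.K2LiuEisensteinResidueOfGenerators.not_mem_of_sum_norm_lt_re P
      (by have : s₂ < w.re := hw; linarith [Complex.re_le_norm w])
    have hwP' : w ∉ P' := Summit.HodgeConjecture.HodgeConjecture.Cruxes.HLiu418.K2LiuEisensteinResidueOfGenerators.not_mem_of_sum_norm_lt_re P'
      (by have : s₂ < w.re := hw; linarith [Complex.re_le_norm w])
    have hQ : ∏ p ∈ P, (w - p) ≠ 0 := prod_sub_ne_zero P hwP
    have hQ' : ∏ p ∈ P', (w - p) ≠ 0 := prod_sub_ne_zero P' hwP'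
    have h := (hterm w hw0 t).mul_const ((∏ p ∈ P, (w - p)) * ∏ p ∈ P', (w - p))
    have hU : (fun t' => (Es w (γ t') / ∏ p ∈ P, (w - p)) * ((∏ p ∈ P, (w - p)) * ∏ p ∈ P', (w - p))) =
        fun t' => Es w (γ t') * ∏ p ∈ P', (w - p) := by
      funext t'
      rw [div_mul_eq_mul_div, mul_comm (∏ p ∈ P, (w - p)) (∏ p ∈ P', (w - p)), ← mul_assoc, mul_div_assoc, div_self hQ, mul_one]
    have hW : (E' w (γ t) / ∏ p ∈ P', (w - p)) * ((∏ p ∈ P, (w - p)) * ∏ p ∈ P', (w - p)) = E' w (γ t) * ∏ p ∈ P, (w - p) := by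
      rw [div_mul_eq_mul_div, ← mul_assoc, mul_div_assoc, div_self hQ', mul_one]
    rw [hU, hW] at h
    exact h

/-- **… and OFF the roots, the QUOTIENT identity** `HasDerivAt (fun t => E⋆ s (γ t)/∏_P(s−p)) (E′ s (γ t)/∏_{P′}(s−p)) t` for every `s ∈ {0 < re} ∖ (P ∪ P′)`.
[cite: MoeglinWaldspurger1995, IV.1.9–IV.1.11] -/
theorem hasDerivAt_continuation_quotient_orbit
    (P : Finset ℂ) (Es : ℂ → HA L e dV hdV dW hdW → ℂ)
    (hd : ∀ h : HA L e dV hdV dW hdW, DifferentiableOn ℂ (fun s => Es s h) {s : ℂ | 0 < s.re})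
    (P' : Finset ℂ) (E' : ℂ → HA L e dV hdV dW hdW → ℂ)
    (hd' : ∀ h : HA L e dV hdV dW hdW, DifferentiableOn ℂ (fun s => E' s h) {s : ℂ | 0 < s.re})
    (hii' : ∀ s : ℂ, 0 < s.re → Continuous (E' s))
    (hv' : ∀ z : ℂ, 0 < z.re → ∃ C A r : ℝ, 0 < r ∧ ∀ s : ℂ, dist s z < r → ∀ h : HA L e dV hdV dW hdW,
      ‖E' s h‖ ≤ C * adelicHeightGL (n + n) L (h : GL (Fin (n + n)) (AdeleRing (𝓞 L) L)) ^ A)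
    (γ : ℝ → HA L e dV hdV dW hdW) (hγc : Continuous γ)
    (hγ : ∀ R : ℝ, ∃ B₁ B₂ : ℝ, 0 < B₁ ∧ ∀ t : ℝ, |t| ≤ R →
      B₁ ≤ adelicHeightGL (n + n) L ((γ t : HA L e dV hdV dW hdW) : GL (Fin (n + n)) (AdeleRing (𝓞 L) L)) ∧
        adelicHeightGL (n + n) L ((γ t : HA L e dV hdV dW hdW) : GL (Fin (n + n)) (AdeleRing (𝓞 L) L)) ≤ B₂)
    {s₁ : ℝ} (hs₁ : 0 ≤ s₁)
    (hterm : ∀ s : ℂ, s₁ < s.re → ∀ t : ℝ,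
      HasDerivAt (fun t => Es s (γ t) / ∏ p ∈ P, (s - p)) (E' s (γ t) / ∏ p ∈ P', (s - p)) t)
    (s : ℂ) (hs : 0 < s.re) (hsP : s ∉ P) (hsP' : s ∉ P') (t : ℝ) :
    HasDerivAt (fun t => Es s (γ t) / ∏ p ∈ P, (s - p)) (E' s (γ t) / ∏ p ∈ P', (s - p)) t := by
  have hQ : ∏ p ∈ P, (s - p) ≠ 0 := prod_sub_ne_zero P hsP
  have hQ' : ∏ p ∈ P', (s - p) ≠ 0 := prod_sub_ne_zero P' hsP'
  have h := (hasDerivAt_continuation_orbit L e dV hdV dW hdW P Es hd P' E' hd' hii' hv' γ hγc hγ hs₁ hterm s hs t).mul_const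
    (((∏ p ∈ P, (s - p)) * ∏ p ∈ P', (s - p))⁻¹)
  have hU : (fun t' => (Es s (γ t') * ∏ p ∈ P', (s - p)) * ((∏ p ∈ P, (s - p)) * ∏ p ∈ P', (s - p))⁻¹) =
      fun t' => Es s (γ t') / ∏ p ∈ P, (s - p) := by
    funext t'
    rw [mul_inv, mul_comm (∏ p ∈ P, (s - p))⁻¹, ← mul_assoc, mul_inv_cancel_right₀ hQ', ← div_eq_mul_inv]
  have hW : (E' s (γ t) * ∏ p ∈ P, (s - p)) * ((∏ p ∈ P, (s - p)) * ∏ p ∈ P', (s - p))⁻¹ = E' s (γ t) / ∏ p ∈ P', (s - p) := by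
    rw [mul_inv, ← mul_assoc, mul_inv_cancel_right₀ hQ, ← div_eq_mul_inv]
  rw [hU, hW] at h
  exact h

end Frame

end Summit.HodgeConjecture.HodgeConjecture.Cruxes.HLiu418.K2LiuContinuationLieDerivative

end
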